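import Mathlib
import HarnessLib
import Summits.AtomisticToContinuum.BoseEinsteinCondensation.Theses.DetailResponseLadder
import Summits.AtomisticToContinuum.BoseEinsteinCondensation.Theorems.GapWindowLadderEngine

/-!
# Route DetailResponseLadder — support item `ResponseEngine` (stmt-AtomisticToContinuum-27068), BY NAME

decomp-a2c lens-6 g13 (the "old E twin" owed since critic rows 103/131). The level-rate response engine of
`DetailResponseLadder` is the box-rate engine of its child `GapWindowLadder`
(`Theorems.GapWindowLadderEngine.gapResponseEngine`, landed p782089) read through RATE MONOTONICITY of loss
laws: a law `λ·16⁻¹pairloss ≤ (E − E₀) + λ·e·N` at the level rate `λ = κ/ℓ_k²` implies the same law at any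
smaller rate, in particular at the box rate `κ/L_N² ≤ κ/ℓ_k²` (`law_mono_rate`, `boxRate_le_levelRate`), and a
row budget `Σ_k e_{K,k} ≤ 11/16` is a fortiori `≤ 3/4`. The two engines differ only in the infrared hypothesis
(level rate, rows ≤ 11/16 here; box rate, rows ≤ 3/4 there), so `ResponseEngine` follows from
`gapResponseEngine` by weakening that hypothesis eventually in `N` (where `L_N > 0`).
-/

noncomputable section

namespace Summit.AtomisticToContinuum.BoseEinsteinCondensation.Theorems.DetailResponseLadderEngine

open scoped BigOperators ENNReal NNReal
open Filter
open Literature.MathematicalPhysics.QuantumManyBody.BoseGas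
open Summit.AtomisticToContinuum.BoseEinsteinCondensation.Theorems.GapWindowLadderEngine

/-- RATE MONOTONICITY of loss laws: a law `r₁·P ≤ X + r₁·a·n` at rate `r₁` implies the law at every rate
`0 ≤ r₂ ≤ r₁` with the same allowance (any real `a`, `n`: `ENNReal.ofReal` clips negatives consistently). -/
theorem law_mono_rate {r₁ r₂ a n : ℝ} {P X : ℝ≥0∞} (h0 : 0 ≤ r₂) (h : r₂ ≤ r₁)
    (hlaw : ENNReal.ofReal r₁ * P ≤ X + ENNReal.ofReal (r₁ * a * n)) :
    ENNReal.ofReal r₂ * P ≤ X + ENNReal.ofReal (r₂ * a * n) := by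
  rcases h0.eq_or_lt with h00 | hpos
  · rw [← h00, ENNReal.ofReal_zero, zero_mul]; exact bot_le
  have hr₁ : 0 < r₁ := hpos.trans_le h
  set s : ℝ := r₂ / r₁ with hs
  have hs0 : 0 ≤ s := by positivity
  have hs1 : s ≤ 1 := (div_le_one hr₁).2 h
  have e1 : ENNReal.ofReal r₂ = ENNReal.ofReal s * ENNReal.ofReal r₁ := by
    rw [← ENNReal.ofReal_mul hs0, hs, div_mul_cancel₀ _ hr₁.ne']
  have e2 : ENNReal.ofReal (r₂ * a * n) = ENNReal.ofReal s * ENNReal.ofReal (r₁ * a * n) := by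
    rw [← ENNReal.ofReal_mul hs0, hs]
    congr 1
    field_simp
  rw [e1, e2, mul_assoc]
  calc ENNReal.ofReal s * (ENNReal.ofReal r₁ * P)
      ≤ ENNReal.ofReal s * (X + ENNReal.ofReal (r₁ * a * n)) := mul_le_mul' le_rfl hlaw
    _ = ENNReal.ofReal s * X + ENNReal.ofReal s * ENNReal.ofReal (r₁ * a * n) := mul_add _ _ _
    _ ≤ 1 * X + ENNReal.ofReal s * ENNReal.ofReal (r₁ * a * n) :=
        add_le_add (mul_le_mul' (ENNReal.ofReal_le_one.2 hs1) le_rfl) le_rfl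
    _ = _ := by rw [one_mul]

/-- **`ResponseEngine` holds** (route DetailResponseLadder, item stmt-AtomisticToContinuum-27068): floor +
bookkeeping + mesoscopic law + level-rate infrared response law ⇒ `HasGroundStateBEC v ρ` — from the box-rate
engine `gapResponseEngine` by rate monotonicity. -/
theorem responseEngine :
    Summit.AtomisticToContinuum.BoseEinsteinCondensation.Theses.DetailResponseLadder.ResponseEngine := by
  intro v ρ M M' hρ hM hM' hF hB hMe hI
  have hEng := gapResponseEngine
  unfold Summit.AtomisticToContinuum.BoseEinsteinCondensation.Theses.GapWindowLadder.GapResponseEngine at hEng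
  refine hEng v ρ M M' hρ hM hM' hF hB hMe ?_
  obtain ⟨κ, hκ, e, he0, hesum, hev⟩ := hI
  refine ⟨κ, hκ, e, he0, fun K => (hesum K).trans (by norm_num), ?_⟩
  filter_upwards [hev, eventually_gt_atTop 0] with N hN hNpos K k hK1 hK2 hk1 hkK Φ
  have hL : 0 < sideLength ρ N := sideLength_pos_of_pos hρ hNpos
  exact law_mono_rate (by positivity) (boxRate_le_levelRate hκ.le hL k) (hN K k hK1 hK2 hk1 hkK Φ)

end Summit.AtomisticToContinuum.BoseEinsteinCondensation.Theorems.DetailResponseLadderEngine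

end
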